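import Mathlib.Analysis.SpecialFunctions.SmoothTransition
import Literature.Topology.FourManifolds.MMSWRasmussenFiniteApproxProofs
import HarnessLib

/-!
# Fibre rotations of the model `M_r = #ʳ(S¹ × S²)` and the invariants `s₋`, `s₊`

Sibling of `MMSWRasmussen.lean` / `MMSWRasmussenFiniteApproxProofs.lean`, towards the named fact
`Literature.Topology.FourManifolds.MMSW.eventually_approxHasRasmussen` (Manolescu–Marengon–
Sarkar–Willis, Duke Math. J. 172 (2023), arXiv:1910.08195, Thm. 1.4 / Prop. 8.2 (i)).

Over the planar domain `Ω_r` the model boundary `M_r = {G_r = 1} ⊂ ℂ²` is the circle bundle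
with fibre coordinate `arg w`, and the maps of MMSW §2.3 that matter for the finite
approximation theorem — the sphere twists `σ^k : (z, w) ↦ (z, w · u(z)^k)` of the tree
(`MMSW.sphereTwist`) and MMSW's own Dehn twists along the belt spheres, which insert the full
twists of `D(k⃗)` at membranes — are all **fibre rotations** `(z, w) ↦ (z, w · φ(z))` by a unit
complex multiplier `φ(z)` depending smoothly on `z`.  This file sets up that class of maps:

* `MMSW.fibreRot φ` — the fibre rotation by `φ : ℂ → ℂ`; `sphereTwist r k = fibreRot (u^k)`
  (`sphereTwist_eq_fibreRot`); composition multiplies the multipliers (`fibreRot_fibreRot`),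
  `φ⁻¹` inverts (`fibreRot_inv_fibreRot`), `z`, the hole terms and (for `|φ| = 1`) the level
  function `G_r` are preserved, so `M_r` is preserved (`fibreRot_mem_modelBoundary`), and points
  off the cores stay off the cores (`wC_fibreRot_ne_zero`);
* `MMSW.IsModelKnot.fibreRot_comp` — **a fibre rotation by a smooth unit multiplier carries model
  knots to model knots** (smooth; injective and immersive through the smooth left inverse
  `fibreRot φ⁻¹`), generalising `IsModelKnot.sphereTwist_comp`;
* `MMSW.isSmoothModelIsotopy_fibreRot` — **a smooth one-parameter family of unit multipliers
  `Φ_t` gives a smooth isotopy of model knots** from `fibreRot Φ₀ ∘ K` to `fibreRot Φ₁ ∘ K`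
  (collared by `Real.smoothTransition`), through core-missing knots if `K` misses the cores;
  hence `s₋`, `s₊` agree at the two ends (`hasSMinus_fibreRot_iff_of_family`, by the proved
  isotopy invariance `HasSMinus.of_isModelIsotopic`) and so do the Rasmussen invariants of every
  finite approximation `D(k⃗)` (`approxHasRasmussen_fibreRot_iff_of_family`, by
  `approxHasRasmussen_iff_of_isotopy`: isotopy extension in `S³`).

The intended use (not carried out here): the closed `1`-form `k · d(Σ_j arg(z - c_j))` on `Ω_r`
is cohomologous to one supported near `r` disjoint arcs from the holes to the outer boundary, and
the straight-line family of multipliers between `u(z)^k` and the corresponding membrane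
multiplier is a family `Φ_t` as above; so `s(finiteApprox r k K) = s(D(0⃗) of the membrane-twisted
knot)`, which is MMSW's `D(k⃗)` (twists inserted at the membranes) — the geometric half of the
identification of the tree's finite approximations with MMSW's.

## References

* C. Manolescu, M. Marengon, S. Sarkar, M. Willis, Duke Math. J. 172 (2023) 231–311,
  arXiv:1910.08195: §2.1, §2.3 and Thm. 2.8 (the generators `σ_i` act by `k ↦ k ± 1`), Prop. 8.2.
  [ManolescuMarengonSarkarWillis2023]
* M. W. Hirsch, *Differential Topology* (1976), Ch. 8 §1 (isotopy; Thm. 1.3 isotopy extension,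
  the tree's `IsotopyExtension.lean`). [HirschDT1976]
-/

open scoped Manifold ContDiff Topology ComplexConjugate
open Function Set

noncomputable section

namespace Literature.Topology.FourManifolds

/-- Local notation: `𝔼 n` is the model Euclidean space `EuclideanSpace ℝ (Fin n)`. -/
local notation "𝔼 " n:arg => EuclideanSpace ℝ (Fin n)

/-- Local notation: `𝕊 n` is the unit sphere in `EuclideanSpace ℝ (Fin (n + 1))`. -/
local notation "𝕊 " n:arg => (Metric.sphere (0 : EuclideanSpace ℝ (Fin (n + 1))) 1)

namespace MMSW

open Literature.AlgebraicTopology.Homotopy.HopfFibration (zC wC ofZW zC_ofZW wC_ofZW ofZW_zC_wC)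

variable {r : ℕ}

/-! ## Fibre rotations -/

/-- **Fibre rotation** of `ℝ⁴ = ℂ²` by the multiplier `φ`: `(z, w) ↦ (z, w · φ(z))`.  For
`|φ| = 1` on the planar domain this is a bundle automorphism of the circle bundle
`M_r ∖ {cores} → Ω_r°` extending over the cores; `σ^k = fibreRot (u^k)`
(`sphereTwist_eq_fibreRot`). [cite: ManolescuMarengonSarkarWillis2023, §2.3] -/
def fibreRot (φ : ℂ → ℂ) (x : 𝔼 4) : 𝔼 4 :=
  ofZW (zC x) (wC x * φ (zC x))

/-- Fibre rotations do not move `z`. [folklore] -/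
@[simp] theorem zC_fibreRot (φ : ℂ → ℂ) (x : 𝔼 4) : zC (fibreRot φ x) = zC x := by
  simp [fibreRot]

/-- Fibre rotations multiply `w` by the multiplier. [folklore] -/
@[simp] theorem wC_fibreRot (φ : ℂ → ℂ) (x : 𝔼 4) : wC (fibreRot φ x) = wC x * φ (zC x) := by
  simp [fibreRot]

/-- The sphere twist `σ^k` is the fibre rotation by `u(z)^k`. [cite: ManolescuMarengonSarkarWillis2023, §2.3] -/
theorem sphereTwist_eq_fibreRot (r : ℕ) (k : ℤ) :
    sphereTwist r k = fibreRot (fun z ↦ twistUnit r z ^ k) :=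
  rfl

/-- Fibre rotations preserve the hole terms. [folklore] -/
@[simp] theorem holeTerm_fibreRot (φ : ℂ → ℂ) (j : Fin r) (x : 𝔼 4) :
    holeTerm r j (fibreRot φ x) = holeTerm r j x := by
  rw [holeTerm_eq_normSq, holeTerm_eq_normSq, zC_fibreRot]

/-- Composing fibre rotations multiplies the multipliers. [folklore] -/
theorem fibreRot_fibreRot (φ ψ : ℂ → ℂ) (x : 𝔼 4) :
    fibreRot ψ (fibreRot φ x) = fibreRot (fun z ↦ φ z * ψ z) x := by
  simp [fibreRot, mul_assoc]

/-- A fibre rotation whose multiplier is `1` at `z` fixes the point. [folklore] -/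
theorem fibreRot_of_apply_eq_one {φ : ℂ → ℂ} {x : 𝔼 4} (h : φ (zC x) = 1) : fibreRot φ x = x := by
  rw [fibreRot, h, mul_one, ofZW_zC_wC]

/-- The fibre rotation by `φ⁻¹` undoes the one by `φ` (where `φ ≠ 0`). [folklore] -/
theorem fibreRot_inv_fibreRot {φ : ℂ → ℂ} {x : 𝔼 4} (h : φ (zC x) ≠ 0) :
    fibreRot (fun z ↦ (φ z)⁻¹) (fibreRot φ x) = x := by
  rw [fibreRot_fibreRot]
  exact fibreRot_of_apply_eq_one (by simp [h])

/-- Unit fibre rotations preserve the level function `G_r`. [folklore] -/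
theorem levelFun_fibreRot {φ : ℂ → ℂ} {x : 𝔼 4} (h : ‖φ (zC x)‖ = 1) :
    levelFun r (fibreRot φ x) = levelFun r x := by
  have h1 : Complex.normSq (φ (zC x)) = 1 := by rw [Complex.normSq_eq_norm_sq, h, one_pow]
  rw [levelFun_eq, levelFun_eq, zC_fibreRot, wC_fibreRot, map_mul, h1, mul_one]

/-- Unit fibre rotations preserve the model boundary `M_r`. [folklore] -/
theorem fibreRot_mem_modelBoundary {φ : ℂ → ℂ} {x : 𝔼 4} (hx : x ∈ modelBoundary r)
    (h : ‖φ (zC x)‖ = 1) : fibreRot φ x ∈ modelBoundary r :=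
  ⟨fun j ↦ by rw [holeTerm_fibreRot]; exact hx.1 j, by rw [levelFun_fibreRot h, hx.2]⟩

/-- Unit fibre rotations keep points off the cores. [folklore] -/
theorem wC_fibreRot_ne_zero {φ : ℂ → ℂ} {x : 𝔼 4} (hw : wC x ≠ 0) (h : φ (zC x) ≠ 0) :
    wC (fibreRot φ x) ≠ 0 := by
  rw [wC_fibreRot]
  exact mul_ne_zero hw h

/-- A fibre rotation is smooth where its multiplier is. [folklore] -/
theorem contDiffAt_fibreRot {φ : ℂ → ℂ} {x : 𝔼 4} {n : WithTop ℕ∞}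
    (hφ : ContDiffAt ℝ n φ (zC x)) : ContDiffAt ℝ n (fibreRot φ) x :=
  contDiff_zC.contDiffAt.ofZW (contDiff_wC.contDiffAt.mul (hφ.comp x contDiff_zC.contDiffAt))

/-! ## Fibre rotations act on model knots -/

/-- **A fibre rotation by a smooth unit multiplier carries model knots to model knots**: smooth
(the multiplier is smooth at the points `z(K)`), injective and immersive (the rotation by `φ⁻¹`
is a smooth left inverse), with image in `M_r` (`|φ| = 1`).  The case `φ = u^k` is
`IsModelKnot.sphereTwist_comp`. [cite: ManolescuMarengonSarkarWillis2023, §2.3] -/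
theorem IsModelKnot.fibreRot_comp {K : 𝕊 1 → 𝔼 4} (hK : IsModelKnot r K) {φ : ℂ → ℂ}
    (hφ : ∀ t, ContDiffAt ℝ ∞ φ (zC (K t))) (h1 : ∀ t, ‖φ (zC (K t))‖ = 1) :
    IsModelKnot r (fibreRot φ ∘ K) := by
  have hne : ∀ t, φ (zC (K t)) ≠ 0 := fun t ↦
    norm_ne_zero_iff.1 (by rw [h1 t]; exact one_ne_zero)
  have hn : (∞ : WithTop ℕ∞) ≠ 0 := by simp
  have hsm : ContMDiff (𝓡 1) 𝓘(ℝ, 𝔼 4) ∞ (fibreRot φ ∘ K) := fun t ↦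
    ((contDiffAt_fibreRot (hφ t)).contMDiffAt).comp t (hK.1 t)
  have hleft : fibreRot (fun z ↦ (φ z)⁻¹) ∘ (fibreRot φ ∘ K) = K :=
    funext fun t ↦ fibreRot_inv_fibreRot (hne t)
  refine ⟨hsm, fun s t hst ↦ ?_, fun t ↦ ?_, fun t ↦ fibreRot_mem_modelBoundary (hK.mem t) (h1 t)⟩
  · have h : fibreRot (fun z ↦ (φ z)⁻¹) (fibreRot φ (K s)) =
        fibreRot (fun z ↦ (φ z)⁻¹) (fibreRot φ (K t)) :=
      congrArg (fibreRot fun z ↦ (φ z)⁻¹) hst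
    rw [fibreRot_inv_fibreRot (hne s), fibreRot_inv_fibreRot (hne t)] at h
    exact hK.2.1 h
  · have hinv : ContDiffAt ℝ ∞ (fun z ↦ (φ z)⁻¹) (zC ((fibreRot φ ∘ K) t)) := by
      rw [Function.comp_apply, zC_fibreRot]
      exact (hφ t).inv (hne t)
    have hd1 : MDifferentiableAt 𝓘(ℝ, 𝔼 4) 𝓘(ℝ, 𝔼 4) (fibreRot fun z ↦ (φ z)⁻¹)
        ((fibreRot φ ∘ K) t) :=
      ((contDiffAt_fibreRot hinv).contMDiffAt (n := ∞)).mdifferentiableAt hn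
    have hd2 : MDifferentiableAt (𝓡 1) 𝓘(ℝ, 𝔼 4) (fibreRot φ ∘ K) t :=
      (hsm t).mdifferentiableAt hn
    have hcomp := mfderiv_comp t hd1 hd2
    rw [hleft] at hcomp
    intro u v huv
    apply hK.2.2.1 t
    rw [hcomp]
    exact congrArg (mfderiv 𝓘(ℝ, 𝔼 4) 𝓘(ℝ, 𝔼 4) (fibreRot fun z ↦ (φ z)⁻¹)
      ((fibreRot φ ∘ K) t)) huv

/-! ## Families of unit multipliers give isotopies of model knots -/

/-- The collar reparametrisation `Real.smoothTransition` is `0` at `0`. [folklore] -/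
theorem smoothTransition_zero' : Real.smoothTransition 0 = 0 :=
  Real.smoothTransition.zero_of_nonpos le_rfl

/-- The collar reparametrisation `Real.smoothTransition` is `1` at `1`. [folklore] -/
theorem smoothTransition_one' : Real.smoothTransition 1 = 1 :=
  Real.smoothTransition.one_of_one_le le_rfl

/-- **Joint smoothness of a family of fibre rotations of a model knot**: if `Φ : ℝ × ℂ → ℂ` is
smooth at the points `(a, z(K t))`, then `(s, t) ↦ fibreRot Φ_{χ(s)} (K t)` is jointly smooth on
`ℝ × 𝕊¹` (`χ = Real.smoothTransition`). [folklore] -/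
theorem contMDiff_fibreRot_family {K : 𝕊 1 → 𝔼 4} (hK : IsModelKnot r K) {Φ : ℝ → ℂ → ℂ}
    (hΦ : ∀ a t, ContDiffAt ℝ ∞ (uncurry Φ) (a, zC (K t))) :
    ContMDiff (𝓘(ℝ, ℝ).prod (𝓡 1)) 𝓘(ℝ, 𝔼 4) ∞
      fun p : ℝ × (𝕊 1) ↦ (fibreRot (Φ (Real.smoothTransition p.1)) ∘ K) p.2 := by
  have hKs : ContMDiff (𝓘(ℝ, ℝ).prod (𝓡 1)) 𝓘(ℝ, 𝔼 4) ∞ fun p : ℝ × (𝕊 1) ↦ K p.2 :=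
    hK.1.comp contMDiff_snd
  have hχ : ContMDiff (𝓘(ℝ, ℝ).prod (𝓡 1)) 𝓘(ℝ, ℝ) ∞
      fun p : ℝ × (𝕊 1) ↦ Real.smoothTransition p.1 :=
    Real.smoothTransition.contDiff.contMDiff.comp contMDiff_fst
  have hpair : ContMDiff (𝓘(ℝ, ℝ).prod (𝓡 1)) (𝓘(ℝ, ℝ).prod 𝓘(ℝ, 𝔼 4)) ∞
      fun p : ℝ × (𝕊 1) ↦ (Real.smoothTransition p.1, K p.2) :=
    hχ.prodMk hKs
  intro p
  -- the outer map `(a, x) ↦ fibreRot (Φ a) x` is smooth at `(χ p.1, K p.2)`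
  have hz : ContDiffAt ℝ ∞ (fun q : ℝ × 𝔼 4 ↦ zC q.2) (Real.smoothTransition p.1, K p.2) :=
    contDiff_zC.contDiffAt.comp _ contDiffAt_snd
  have hw' : ContDiffAt ℝ ∞ (fun q : ℝ × 𝔼 4 ↦ wC q.2) (Real.smoothTransition p.1, K p.2) :=
    contDiff_wC.contDiffAt.comp _ contDiffAt_snd
  have hΦq : ContDiffAt ℝ ∞ (fun q : ℝ × 𝔼 4 ↦ Φ q.1 (zC q.2))
      (Real.smoothTransition p.1, K p.2) := by
    have h := (hΦ (Real.smoothTransition p.1) p.2).comp (Real.smoothTransition p.1, K p.2)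
      (contDiffAt_fst.prodMk hz)
    exact h
  have hout : ContDiffAt ℝ ∞ (fun q : ℝ × 𝔼 4 ↦ fibreRot (Φ q.1) q.2)
      (Real.smoothTransition p.1, K p.2) :=
    hz.ofZW (hw'.mul hΦq)
  have hout' : ContMDiffAt (𝓘(ℝ, ℝ).prod 𝓘(ℝ, 𝔼 4)) 𝓘(ℝ, 𝔼 4) ∞
      (fun q : ℝ × 𝔼 4 ↦ fibreRot (Φ q.1) q.2) (Real.smoothTransition p.1, K p.2) := by
    have h := hout.contMDiffAt
    rw [modelWithCornersSelf_prod, ← chartedSpaceSelf_prod] at h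
    exact h
  have h := hout'.comp p (hpair p)
  exact h

/-- Each multiplier `Φ_a` of a family smooth at `(a, z(K t))` is smooth at `z(K t)`. [folklore] -/
theorem contDiffAt_of_family {K : 𝕊 1 → 𝔼 4} {Φ : ℝ → ℂ → ℂ}
    (hΦ : ∀ a t, ContDiffAt ℝ ∞ (uncurry Φ) (a, zC (K t))) (a : ℝ) (t : 𝕊 1) :
    ContDiffAt ℝ ∞ (Φ a) (zC (K t)) :=
  (hΦ a t).comp (zC (K t)) (contDiffAt_const.prodMk contDiffAt_id)

/-- **A smooth family of unit multipliers gives a smooth isotopy of model knots.**  If `K` is a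
model knot and `Φ : ℝ × ℂ → ℂ` is smooth at the points `(a, z(K t))` with `|Φ_a(z(K t))| = 1`,
then `s ↦ fibreRot Φ_{χ(s)} ∘ K` (`χ = Real.smoothTransition`, so that the family is collared)
is a smooth isotopy of model knots from `fibreRot Φ₀ ∘ K` to `fibreRot Φ₁ ∘ K`
(`IsSmoothModelIsotopy`). [cite: HirschDT1976, Ch. 8 §1] -/
theorem isSmoothModelIsotopy_fibreRot {K : 𝕊 1 → 𝔼 4} (hK : IsModelKnot r K) {Φ : ℝ → ℂ → ℂ}
    (hΦ : ∀ a t, ContDiffAt ℝ ∞ (uncurry Φ) (a, zC (K t)))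
    (h1 : ∀ a t, ‖Φ a (zC (K t))‖ = 1) :
    IsSmoothModelIsotopy r (fibreRot (Φ 0) ∘ K) (fibreRot (Φ 1) ∘ K) := by
  refine ⟨fun s ↦ fibreRot (Φ (Real.smoothTransition s)) ∘ K, contMDiff_fibreRot_family hK hΦ,
    fun s hs ↦ ?_, fun s hs ↦ ?_,
    fun s ↦ hK.fibreRot_comp (contDiffAt_of_family hΦ _) (h1 _)⟩
  · show fibreRot (Φ (Real.smoothTransition s)) ∘ K = fibreRot (Φ 0) ∘ K
    rw [Real.smoothTransition.zero_of_nonpos hs]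
  · show fibreRot (Φ (Real.smoothTransition s)) ∘ K = fibreRot (Φ 1) ∘ K
    rw [Real.smoothTransition.one_of_one_le hs]

/-- **`s₋` agrees at the ends of a family of unit fibre rotations** (isotopy invariance of `s₋`,
`HasSMinus.of_isModelIsotopic`, along `isSmoothModelIsotopy_fibreRot`).
[cite: ManolescuMarengonSarkarWillis2023, Thm. 1.3] -/
theorem hasSMinus_fibreRot_iff_of_family {K : 𝕊 1 → 𝔼 4} (hK : IsModelKnot r K)
    {Φ : ℝ → ℂ → ℂ} (hΦ : ∀ a t, ContDiffAt ℝ ∞ (uncurry Φ) (a, zC (K t)))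
    (h1 : ∀ a t, ‖Φ a (zC (K t))‖ = 1) (s : ℤ) :
    HasSMinus r (fibreRot (Φ 0) ∘ K) s ↔ HasSMinus r (fibreRot (Φ 1) ∘ K) s :=
  ((isSmoothModelIsotopy_fibreRot hK hΦ h1).isModelIsotopic).hasSMinus_iff s

/-- **The Rasmussen invariants of every finite approximation agree at the ends of a family of
unit fibre rotations of a core-missing model knot** (the isotopy stays off the cores, so
`approxHasRasmussen_iff_of_isotopy` — isotopy extension in `S³` — applies).
[cite: HirschDT1976, Ch. 8 §1, Thm. 1.3] -/
theorem approxHasRasmussen_fibreRot_iff_of_family {K : 𝕊 1 → 𝔼 4} (hK : IsModelKnot r K)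
    (hw : ∀ t, wC (K t) ≠ 0) {Φ : ℝ → ℂ → ℂ}
    (hΦ : ∀ a t, ContDiffAt ℝ ∞ (uncurry Φ) (a, zC (K t)))
    (h1 : ∀ a t, ‖Φ a (zC (K t))‖ = 1) (k : ℤ) (s : ℤ) :
    ApproxHasRasmussen r k (fibreRot (Φ 0) ∘ K) s ↔
      ApproxHasRasmussen r k (fibreRot (Φ 1) ∘ K) s := by
  have hne : ∀ a t, Φ a (zC (K t)) ≠ 0 := fun a t ↦
    norm_ne_zero_iff.1 (by rw [h1 a t]; exact one_ne_zero)
  refine approxHasRasmussen_iff_of_isotopy (H := fun a ↦ fibreRot (Φ (Real.smoothTransition a)) ∘ K)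
    (contMDiff_fibreRot_family hK hΦ) ?_ ?_
    (fun a ↦ hK.fibreRot_comp (contDiffAt_of_family hΦ _) (h1 _))
    (fun a t ↦ wC_fibreRot_ne_zero (hw t) (hne _ t)) k s
  · show fibreRot (Φ (Real.smoothTransition 0)) ∘ K = fibreRot (Φ 0) ∘ K
    rw [smoothTransition_zero']
  · show fibreRot (Φ (Real.smoothTransition 1)) ∘ K = fibreRot (Φ 1) ∘ K
    rw [smoothTransition_one']

/-- **The sphere-twisted knot `σ^k ∘ K` versus any unit-homotopic fibre rotation.**  If the
family `Φ` as above starts at `Φ₀ = u^k` (so `fibreRot Φ₀ = σ^k`), then for a core-missing model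
knot `K` in `M_r` the Rasmussen invariants of `D(j⃗ + k⃗)` of `K` are those of `D(j⃗)` of
`fibreRot Φ₁ ∘ K` — the form in which a membrane-supported multiplier `Φ₁` replaces the spread-out
twist `u^k` of the tree's finite approximations. [cite: ManolescuMarengonSarkarWillis2023, Thm. 2.8 (proof)] -/
theorem approxHasRasmussen_iff_fibreRot_of_family {K : 𝕊 1 → 𝔼 4} (hK : IsModelKnot r K)
    (hw : ∀ t, wC (K t) ≠ 0) {Φ : ℝ → ℂ → ℂ}
    (hΦ : ∀ a t, ContDiffAt ℝ ∞ (uncurry Φ) (a, zC (K t)))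
    (h1 : ∀ a t, ‖Φ a (zC (K t))‖ = 1) {k : ℤ} (h0 : Φ 0 = fun z ↦ twistUnit r z ^ k)
    (j : ℤ) (s : ℤ) :
    ApproxHasRasmussen r (k + j) K s ↔ ApproxHasRasmussen r j (fibreRot (Φ 1) ∘ K) s := by
  rw [← approxHasRasmussen_sphereTwist_comp_iff hK.mem k j s, sphereTwist_eq_fibreRot, ← h0]
  exact approxHasRasmussen_fibreRot_iff_of_family hK hw hΦ h1 j s

end MMSW

end Literature.Topology.FourManifolds

end
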